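import Mathlib
import HarnessLib

/-!
# Tropical tori: compound coordinates, the eigenwave, framed simplicial cycles, formal cycles over a
# linear family, and the `ℚ(i)`-hermitian (Weil-type) family with its theta and Weil classes

Kontsevich's degeneration test for the Hodge conjecture (Zharkov, arXiv:2002.02347, pp. 1–3) lives on a
principally polarised TROPICAL torus `X = V/Γ₁`, `V = ℝ^g`, slope lattice `Γ₂ = ℤ^g ⊂ V`, period
lattice `Γ₁ = Pℤ^g` (`P ∈ M_g(ℝ)` symmetric positive definite; Mikhalkin–Zharkov, arXiv:1302.0252,
Def. 6.1): its tropical homology is `H_q(X; 𝓕_p) = ⋀^q Γ₁ ⊗ ⋀^p Γ₂`, the tropical Hodge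
`(p,p)`-classes are "the kernel of the eigenwave action map `φ : ⋀^p Γ₁ ⊗ ⋀^p Γ₂ → ⋀^{p-1} Γ₁ ⊗
⋀^{p+1} V`" (Zharkov p. 2; MZ §5.1–5.2, Thm. 5.4), an algebraic tropical `p`-cycle `Z` (balanced
weighted polyhedral complex with `Γ₂`-rational slopes) has the tautological class `vol(Z)`, "framing
every (oriented) cell with its integral volume element in `⋀^p Γ₂`; the balancing condition
guaranties that this chain is a polyhedral `p`-cycle with coefficients in `⋀^p Γ₂`" (Zharkov p. 2;
MZ Def. 4.2, Prop. 4.3), and Kontsevich's countable reformulation takes cycles "which vary rationally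
over the space of parameters", i.e. with vertices in `Γ₂ ⊗ Γ_p` (Zharkov p. 3). This file gives
FINITE-DIMENSIONAL, COORDINATE-BOUND definitions of exactly these objects, for every `g` and `p`,
so that statements about them are one-line `Prop`s:

* `Sub g p` — `p`-subsets of `Fin g` (basis `e_K` of `⋀^p ℚ^g`); `minor`, `compound p A` — the
  `p`-th compound matrix (`⋀^p A` in the basis `e_K`); `pluecker D` — Plücker vector of a `g × p`
  frame. A class `c = Σ M_{IJ} γ_I ⊗ e_J` (`γ_i = P e_i` the period basis) has V-COORDINATES
  `compound p P * M` (entry `(K,J)` = coefficient of `e_K ⊗ e_J`).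
* `eigenwave` — Zharkov's `φ` in V-coordinates: `e_K ⊗ e_J ↦ Σ_{k ∈ K} ± e_{K∖k} ⊗ (e_k ∧ e_J)`
  (MZ Thm. 5.4: "any vector parallel to a simplex … turns to zero after the wedge product with the
  volume element"); `hodgeClasses P q` — the `ℚ`-module of `M` with `φ(compound P · M) = 0`
  (degree `p = q + 1`).
* `Cell`, `Chain` — framed simplicial `p`-chains: a cell is a base vertex, a rational `g × p`
  direction frame `D`, a `p × p` coefficient matrix `a` (edge `i` = `Σ_j a_{ij} D_j`) and a weight
  `m ∈ ℚ`; its framing is `m · pluecker D ∈ ⋀^p ℚ^g` and its class `vol⃗ ⊗ framing` with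
  `vol⃗ = (1/p!) det(a) · pluecker D` (`Cell.classOf`). `Chain.IsCycle Per` — the alternating
  simplicial boundary vanishes MODULO TRANSLATION by the period lattice `Per · ℤ^g` (closed ⇔
  balanced, Zharkov p. 2); `Chain.Effective` — `m · det a > 0` (positive weight, framing oriented
  with the cell); `effectiveSpan P p` — the `ℚ`-span of classes of effective tropical `p`-cycles.
* FORMAL chains = the same structures over `S = MvPolynomial σ ℚ` with `Chain.IsAffineLinear`
  (vertices affine-linear in the parameters) and periods `weilPeriod (genericParam n)`.
* `weilPeriod T` — the `n²`-parameter family `P = [[Re H, -Im H], [Im H, Re H]]` of realified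
  hermitian `n × n` matrices (upper triangle of `T` = `Re H`, strict lower triangle = `Im H`); for
  `n = 2` it is literally Zharkov's `Q_{a,b,c,e}` with `d = 1` (p. 2). `weilVector`, `weilMatrix₁/₂`
  — the coefficients of `𝘄 = ⋀_{j<n} (e_j - i e_{n+j})` and `Re/Im (𝘄 ⊗ 𝘄)`, the two Weil classes in
  period coordinates (Zharkov's `w₁, w₂` for `n = 2`, up to the basis normalisation there);
  `weilClass₁/₂ T` — their V-coordinates; the theta class `θ_p = Σ_I γ_I ⊗ e_I` has V-coordinates
  `compound p (weilPeriod T)` (Zharkov's `θ = Σ γ_{ij} ⊗ e_{ij}`).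

Design. Everything is stated over a commutative `ℚ`-algebra `S` (`ℝ` for cycles on one torus,
`MvPolynomial σ ℚ` for formal cycles), all index sets are finite, cells are ORDERED simplices and
faces are identified up to a permutation (with sign) and a period translation, degenerate cells are
allowed (they contribute `0`), and no convexity is imposed (a simplex is the convex hull of its
vertices by fiat). Sign conventions of `eigenwave` reproduce the kernel-checked `g = 4` tables of the
2001 programme (`phi2`, stockroom `Hodge_NegY1_TropicalHodgeAllD`). NOT here: tropical spaces other
than tori, Berkovich analytification / tropicalisation of algebraic cycles (needed to PROVE the
specialisation principle, not to state it), intersection products, and any claim — this file is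
definitions only; the statements using them are route items of `HodgeConjecture`.

## References

* [Zharkov2020TropicalWeil] I. Zharkov, Tropical abelian varieties, Weil classes and the Hodge
  conjecture, arXiv:2002.02347 (2020), pp. 1–3.
* [MikhalkinZharkov2014Eigenwave] G. Mikhalkin, I. Zharkov, Tropical eigenwave and intermediate
  Jacobians, in: Homological Mirror Symmetry and Tropical Geometry, LN UMI 15 (2014), arXiv:1302.0252,
  Def. 4.2, Prop. 4.3, §5.1–5.2, Thm. 5.4, Def. 6.1.
-/

noncomputable section

open scoped BigOperators

namespace Literature.AlgebraicGeometry.Tropical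

namespace TropicalTorus

variable {S : Type*} [CommRing S]

/-! ### Exterior-power coordinates -/

/-- The `p`-element subsets of `Fin g`: the index set of the basis `e_K = e_{k₁} ∧ … ∧ e_{k_p}`
(`k₁ < … < k_p`) of `⋀^p ℚ^g`. [folklore] -/
abbrev Sub (g p : ℕ) : Type := {s : Finset (Fin g) // s.card = p}

/-- The `(I, J)` minor of a square matrix: `det` of the rows `I` and columns `J`, both read in
increasing order. [folklore] -/
def minor {g p : ℕ} (A : Matrix (Fin g) (Fin g) S) (I J : Sub g p) : S :=
  (A.submatrix (I.1.orderEmbOfFin I.2) (J.1.orderEmbOfFin J.2)).det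

/-- The `p`-th compound matrix `⋀^p A` in the basis `e_K`: `(compound p A) K I = minor A K I`, so that
`⋀_{i ∈ I} A e_i = Σ_K (compound p A) K I · e_K`. For the period matrix `P` (columns `γ_i = P e_i`)
the class `Σ M_{IJ} γ_I ⊗ e_J` has V-coordinates `compound p P * M`. [folklore] -/
def compound {g : ℕ} (p : ℕ) (A : Matrix (Fin g) (Fin g) S) : Matrix (Sub g p) (Sub g p) S :=
  Matrix.of fun K I => minor A K I

/-- The Plücker vector of a `g × p` frame `D` (columns `D₁, …, D_p`): `(D₁ ∧ … ∧ D_p)_K =` the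
`p × p` minor of `D` on the rows `K`. [folklore] -/
def pluecker {g p : ℕ} (D : Matrix (Fin g) (Fin p) S) (K : Sub g p) : S :=
  (D.submatrix (K.1.orderEmbOfFin K.2) id).det

/-- The EIGENWAVE of a tropical torus in V-coordinates (Zharkov p. 2, after Mikhalkin–Zharkov
§5.1–5.2): `φ : ⋀^{q+1} V ⊗ ⋀^{q+1} V → ⋀^q V ⊗ ⋀^{q+2} V`, `e_K ⊗ e_J ↦ Σ_{k ∈ K} (-1)^{pos_K(k)}
e_{K∖k} ⊗ (e_k ∧ e_J)`, with `e_k ∧ e_J = (-1)^{#{j ∈ J : j < k}} e_{J ∪ k}` (`0` if `k ∈ J`). As a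
matrix: `(φ C) K' J' = Σ_{k ∈ J' ∖ K'} (-1)^{#{k' ∈ K' : k' < k} + #{j ∈ J' : j < k}} C (K' ∪ k) (J' ∖ k)`.
[cite: Zharkov2020TropicalWeil, p. 2] -/
def eigenwave {g q : ℕ} (C : Matrix (Sub g (q + 1)) (Sub g (q + 1)) S) :
    Matrix (Sub g q) (Sub g (q + 2)) S :=
  Matrix.of fun K J => ∑ k : Fin g,
    if h : k ∉ K.1 ∧ k ∈ J.1 then
      (-1 : S) ^ ((K.1.filter (· < k)).card + (J.1.filter (· < k)).card) *
        C ⟨insert k K.1, by rw [Finset.card_insert_of_notMem h.1, K.2]⟩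
          ⟨J.1.erase k, by rw [Finset.card_erase_of_mem h.2, J.2]; rfl⟩
    else 0

/-- The eigenwave is additive (it is linear in the class). [folklore] -/
theorem eigenwave_add {g q : ℕ} (C D : Matrix (Sub g (q + 1)) (Sub g (q + 1)) S) :
    eigenwave (C + D) = eigenwave C + eigenwave D := by
  ext K J
  simp only [eigenwave, Matrix.of_apply, Matrix.add_apply, ← Finset.sum_add_distrib]
  refine Finset.sum_congr rfl fun k _ => ?_
  split_ifs <;> simp [mul_add]

/-- The eigenwave commutes with scalars (it is linear in the class). [folklore] -/
theorem eigenwave_smul {g q : ℕ} (s : S) (C : Matrix (Sub g (q + 1)) (Sub g (q + 1)) S) :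
    eigenwave (s • C) = s • eigenwave C := by
  ext K J
  simp only [eigenwave, Matrix.of_apply, Matrix.smul_apply, smul_eq_mul, Finset.mul_sum]
  refine Finset.sum_congr rfl fun k _ => ?_
  split_ifs <;> ring

/-- The eigenwave of the zero class vanishes. [folklore] -/
theorem eigenwave_zero {g q : ℕ} :
    eigenwave (0 : Matrix (Sub g (q + 1)) (Sub g (q + 1)) S) = 0 := by
  ext K J
  simp [eigenwave]

/-- The TROPICAL HODGE `(p,p)`-CLASSES of the torus `ℝ^g / P ℤ^g` (slope lattice `ℤ^g`), `p = q + 1`,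
in period coordinates: the rational `M` (class `Σ M_{IJ} γ_I ⊗ e_J ∈ ⋀^p Γ₁ ⊗ ⋀^p Γ₂ ⊗ ℚ`) killed by
the eigenwave, "the kernel of the eigenwave action map" (Zharkov p. 2). A `ℚ`-submodule of
`Matrix (Sub g p) (Sub g p) ℚ`. [cite: Zharkov2020TropicalWeil, p. 2] -/
def hodgeClasses {g : ℕ} (P : Matrix (Fin g) (Fin g) ℝ) (q : ℕ) :
    Submodule ℚ (Matrix (Sub g (q + 1)) (Sub g (q + 1)) ℚ) where
  carrier := {M | eigenwave (compound (q + 1) P * M.map (algebraMap ℚ ℝ)) = 0}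
  zero_mem' := by simp [eigenwave_zero]
  add_mem' {M N} hM hN := by
    simp only [Set.mem_setOf_eq] at hM hN ⊢
    have : (M + N).map (algebraMap ℚ ℝ) = M.map (algebraMap ℚ ℝ) + N.map (algebraMap ℚ ℝ) := by
      ext i j; simp
    rw [this, Matrix.mul_add, eigenwave_add, hM, hN, add_zero]
  smul_mem' c {M} hM := by
    simp only [Set.mem_setOf_eq] at hM ⊢
    have : (c • M).map (algebraMap ℚ ℝ) = (algebraMap ℚ ℝ c) • M.map (algebraMap ℚ ℝ) := by
      ext i j; simp
    rw [this, Matrix.mul_smul, eigenwave_smul, hM, smul_zero]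

/-! ### Framed simplicial chains on a torus `S^g / Per·ℤ^g` -/

/-- A FRAMED `p`-CELL with coordinates in the `ℚ`-algebra `S`: base vertex `base ∈ S^g`, rational
direction frame `dir` (`g × p`, columns `D_j ∈ ℚ^g` — "`Γ₂`-rational slopes"), coefficient matrix
`coef` (edge `i` of the simplex is `Σ_j coef i j · D_j ∈ S^g`) and weight `weight ∈ ℚ`. Its ordered
vertices are `v₀ = base`, `v_{i+1} = base + edge i`; its framing is `weight · (D₁ ∧ … ∧ D_p)`
(Zharkov p. 2: each oriented cell framed by a volume element of its slope lattice; MZ Def. 4.2).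
Degenerate data (`det coef = 0` or `rank dir < p`) is allowed and contributes nothing.
[cite: Zharkov2020TropicalWeil, pp. 2–3] -/
structure Cell (S : Type*) (g p : ℕ) where
  /-- the vertex `v₀` -/
  base : Fin g → S
  /-- the rational direction frame `D` (columns span the slope space `L_σ ⊗ ℚ`) -/
  dir : Matrix (Fin g) (Fin p) ℚ
  /-- edge `i` is `Σ_j coef i j · D_j` -/
  coef : Matrix (Fin p) (Fin p) S
  /-- the rational weight (either sign; positivity is `Chain.Effective`) -/
  weight : ℚ

/-- A FRAMED SIMPLICIAL `p`-CHAIN: finitely many framed cells (a finite formal sum).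
[cite: Zharkov2020TropicalWeil, pp. 2–3] -/
structure Chain (S : Type*) (g p : ℕ) where
  /-- number of cells -/
  size : ℕ
  /-- the cells -/
  cell : Fin size → Cell S g p

variable [Algebra ℚ S] {g p : ℕ}

namespace Cell

/-- Edge `i` of a cell: `Σ_j coef i j · D_j ∈ S^g`. [folklore] -/
def edge (c : Cell S g p) (i : Fin p) : Fin g → S :=
  fun r => ∑ j, algebraMap ℚ S (c.dir r j) * c.coef i j

/-- The ordered vertices `v₀ = base`, `v_{i+1} = base + edge i` of a cell. [folklore] -/
def vertex (c : Cell S g p) : Fin (p + 1) → Fin g → S :=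
  Fin.cases c.base fun i => c.base + c.edge i

/-- The `i`-th face of a cell: the ordered `p`-tuple of vertices omitting `v_i`. [folklore] -/
def face (c : Cell S g p) (i : Fin (p + 1)) : Fin p → Fin g → S :=
  fun j => c.vertex (i.succAbove j)

/-- The framing `weight · (D₁ ∧ … ∧ D_p) ∈ ⋀^p ℚ^g` of a cell, in the basis `e_K`.
[cite: Zharkov2020TropicalWeil, p. 2] -/
def framing (c : Cell S g p) : Sub g p → ℚ :=
  fun K => c.weight * pluecker c.dir K

/-- The tautological class `vol⃗(σ) ⊗ framing(σ) ∈ ⋀^p S^g ⊗ ⋀^p ℚ^g` of a cell, as a matrix in the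
basis `e_K ⊗ e_J`: `vol⃗(σ) = (1/p!) · edge₁ ∧ … ∧ edge_p = (1/p!) det(coef) · (D₁ ∧ … ∧ D_p)`
(Zharkov p. 2, "its area form equipped with the unit area element", p. 3; MZ Prop. 4.3).
[cite: Zharkov2020TropicalWeil, pp. 2–3] -/
def classOf (c : Cell S g p) : Matrix (Sub g p) (Sub g p) S :=
  Matrix.of fun K J =>
    algebraMap ℚ S (((Nat.factorial p : ℚ)⁻¹ * pluecker c.dir K) * c.framing J) * c.coef.det

end Cell

/-- Two ordered `p`-tuples of points of `S^g` are translates by a PERIOD: `τ' = τ + Per · k` for one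
`k ∈ ℤ^g` (the same for every vertex). [folklore] -/
def IsTranslate (Per : Matrix (Fin g) (Fin g) S) (τ τ' : Fin p → Fin g → S) : Prop :=
  ∃ k : Fin g → ℤ, ∀ j, τ' j = τ j + Per.mulVec fun r => (k r : S)

namespace Chain

open Classical in
/-- The coefficient at the ordered `(p-1)`-simplex `τ` (of the torus `S^g / Per·ℤ^g`) of the
ALTERNATING SIMPLICIAL BOUNDARY of a framed chain: the sum of `sign(π) · (-1)^i · framing(σ)` over
all cells `σ`, face indices `i` and vertex permutations `π` with `face_i(σ) ∘ π` a period-translate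
of `τ`. [cite: Zharkov2020TropicalWeil, p. 2] -/
def boundaryCoeff (Per : Matrix (Fin g) (Fin g) S) (Z : Chain S g p) (τ : Fin p → Fin g → S) :
    Sub g p → ℚ :=
  ∑ c : Fin Z.size, ∑ i : Fin (p + 1), ∑ π : Equiv.Perm (Fin p),
    if IsTranslate Per τ ((Z.cell c).face i ∘ π) then
      (((Equiv.Perm.sign π : ℤˣ) : ℤ) * (-1) ^ (i : ℕ) : ℚ) • (Z.cell c).framing
    else 0

/-- A framed chain is a TROPICAL `p`-CYCLE of the torus `S^g / Per·ℤ^g` when its framed boundary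
vanishes modulo period translations — the chain-level form of the balancing condition ("the
balancing condition guaranties that this chain is a polyhedral `p`-cycle with coefficients in
`⋀^p Γ₂`", Zharkov p. 2). [cite: Zharkov2020TropicalWeil, p. 2] -/
def IsCycle (Per : Matrix (Fin g) (Fin g) S) (Z : Chain S g p) : Prop :=
  ∀ τ : Fin p → Fin g → S, Z.boundaryCoeff Per τ = 0

/-- The tautological class `vol(Z) = Σ_σ vol⃗(σ) ⊗ framing(σ)` of a framed chain, in V-coordinates
(basis `e_K ⊗ e_J`). For a cycle of `ℝ^g / Pℤ^g` it lies in `compound p P · (hodgeClasses P)`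
(MZ Thm. 5.4). [cite: Zharkov2020TropicalWeil, p. 2] -/
def classOf (Z : Chain S g p) : Matrix (Sub g p) (Sub g p) S :=
  ∑ c : Fin Z.size, (Z.cell c).classOf

/-- EFFECTIVE real chains: every cell has `weight · det(coef) > 0`, i.e. positive weight with the
framing oriented like the cell (an algebraic = effective tropical cycle, Zharkov p. 2). [cite: Zharkov2020TropicalWeil, p. 2] -/
def Effective (Z : Chain ℝ g p) : Prop :=
  ∀ c : Fin Z.size, 0 < ((Z.cell c).weight : ℝ) * (Z.cell c).coef.det

/-- FORMAL chains over a parameter space: all vertex data are affine-linear in the parameters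
(Kontsevich: tropical cycles "which vary rationally over the space of parameters", vertices in
`Γ₂ ⊗ Γ_p`, Zharkov p. 3). [cite: Zharkov2020TropicalWeil, p. 3] -/
def IsAffineLinear {σ : Type*} (Z : Chain (MvPolynomial σ ℚ) g p) : Prop :=
  ∀ c : Fin Z.size, (∀ r, ((Z.cell c).base r).totalDegree ≤ 1) ∧
    ∀ i j, ((Z.cell c).coef i j).totalDegree ≤ 1

end Chain

/-- The `ℚ`-SPAN OF THE CLASSES OF EFFECTIVE TROPICAL `p`-CYCLES of the torus `ℝ^g / Pℤ^g`, inside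
`⋀^p ℝ^g ⊗ ⋀^p ℚ^g` (V-coordinates). The tropical Hodge conjecture for the torus in degree `(p,p)`
says it equals `compound p P · hodgeClasses P (p-1)` (Zharkov p. 2: "every Hodge class is
represented by an algebraic cycle"). [cite: Zharkov2020TropicalWeil, p. 2] -/
def effectiveSpan (P : Matrix (Fin g) (Fin g) ℝ) (p : ℕ) : Submodule ℚ (Matrix (Sub g p) (Sub g p) ℝ) :=
  Submodule.span ℚ {M | ∃ Z : Chain ℝ g p, Z.IsCycle P ∧ Z.Effective ∧ Z.classOf = M}

/-! ### The hermitian (Weil-type) family and its theta and Weil classes -/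

variable {n : ℕ}

/-- `Re H` of the hermitian matrix `H` encoded by `T`: the upper triangle (with diagonal) of `T`,
symmetrised. [cite: Zharkov2020TropicalWeil, p. 2] -/
def hermRe (T : Matrix (Fin n) (Fin n) S) : Matrix (Fin n) (Fin n) S :=
  Matrix.of fun i j => if i ≤ j then T i j else T j i

/-- `Im H` of the hermitian matrix `H` encoded by `T`: the strict lower triangle of `T`,
antisymmetrised. [cite: Zharkov2020TropicalWeil, p. 2] -/
def hermIm (T : Matrix (Fin n) (Fin n) S) : Matrix (Fin n) (Fin n) S :=
  Matrix.of fun i j => if j < i then T i j else if i < j then -T j i else 0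

/-- The PERIOD MATRIX of the `n²`-parameter hermitian family: the realification
`P = [[Re H, -Im H], [Im H, Re H]] ∈ M_{2n}(S)` of `H = Re H + i Im H` (multiplication by `H` on
`ℂ^n = ℝ^n ⊕ iℝ^n`; it commutes with `J(x, y) = (-y, x)`). Columns `γ_i = P e_i` span the period
lattice of `X_P = ℝ^{2n} / Pℤ^{2n}`; `X_P` is a principally polarised tropical abelian variety when
`P` is positive definite (MZ Def. 6.1), of Weil type for `ℚ(i)`. For `n = 2`,
`T = [[a, b], [e, c]]` gives Zharkov's `Q_{a,b,c,e}` with `d = 1`. [cite: Zharkov2020TropicalWeil, p. 2] -/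
def weilPeriod (T : Matrix (Fin n) (Fin n) S) : Matrix (Fin (n + n)) (Fin (n + n)) S :=
  Matrix.reindex finSumFinEquiv finSumFinEquiv
    (Matrix.fromBlocks (hermRe T) (-hermIm T) (hermIm T) (hermRe T))

/-- The generic parameter: the matrix of indeterminates `X_{(i,j)}` of `ℚ[X_{(i,j)} : i, j < n]`, so
that `weilPeriod (genericParam n)` is the period matrix with polynomial entries and evaluation
`MvPolynomial.aeval (fun ij => T ij.1 ij.2)` specialises it to `weilPeriod T`. [folklore] -/
def genericParam (n : ℕ) : Matrix (Fin n) (Fin n) (MvPolynomial (Fin n × Fin n) ℚ) :=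
  Matrix.of fun i j => MvPolynomial.X (i, j)

/-- The index set `I(A) = {j : j ∉ A} ∪ {n + j : j ∈ A} ⊆ Fin (n+n)` of the monomial of
`𝘄 = ⋀_{j<n} (e_j - i e_{n+j})` choosing the factor `-i e_{n+j}` exactly for `j ∈ A`. [folklore] -/
def weilIndex (A : Finset (Fin n)) : Finset (Fin (n + n)) :=
  (Aᶜ.image (Fin.castAdd n)) ∪ (A.image (Fin.natAdd n))

/-- Reordering sign exponent of the monomial `I(A)` of `𝘄`: the number of pairs `j < j'` with
`j ∈ A`, `j' ∉ A` (each such pair is one transposition `e_{n+j} ↔ e_{j'}`). [folklore] -/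
def weilInv (A : Finset (Fin n)) : ℕ :=
  ((A ×ˢ Aᶜ).filter fun x => x.1 < x.2).card

/-- The Gaussian-integer coefficients of `𝘄 = ⋀_{j<n} (e_j - i·e_{n+j}) ∈ ⋀^n ℤ[i]^{2n}` in the basis
`e_K`: `𝘄_{I(A)} = (-i)^{#A} (-1)^{weilInv A}`, all other coefficients `0`. `𝘄` spans the top exterior
power of the `i`-eigenspace of `J`, so `⋀^n P · 𝘄 = det(H) · 𝘄` for `P = weilPeriod T`.
[cite: Zharkov2020TropicalWeil, p. 2] -/
def weilVector (n : ℕ) (K : Sub (n + n) n) : GaussianInt :=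
  ∑ A : Finset (Fin n), if K.1 = weilIndex A then (-⟨0, 1⟩) ^ A.card * (-1) ^ weilInv A else 0

/-- The first WEIL CLASS in period coordinates: `w₁ = Re (𝘄 ⊗ 𝘄)`, i.e. `M_{IJ} = Re (𝘄_I 𝘄_J)`
(class `Σ M_{IJ} γ_I ⊗ e_J`; for `n = 2` Zharkov's `w₁` up to his normalisation of the basis).
[cite: Zharkov2020TropicalWeil, p. 2] -/
def weilMatrix₁ (n : ℕ) : Matrix (Sub (n + n) n) (Sub (n + n) n) ℤ :=
  Matrix.of fun I J => (weilVector n I * weilVector n J).re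

/-- The second WEIL CLASS in period coordinates: `w₂ = Im (𝘄 ⊗ 𝘄)`. [cite: Zharkov2020TropicalWeil, p. 2] -/
def weilMatrix₂ (n : ℕ) : Matrix (Sub (n + n) n) (Sub (n + n) n) ℤ :=
  Matrix.of fun I J => (weilVector n I * weilVector n J).im

/-- The first Weil class of `X_{weilPeriod T}` in V-COORDINATES: `compound n P · w₁`. (The theta
class `θ_n = Σ_I γ_I ⊗ e_I`, Zharkov's `θ`, has V-coordinates `compound n P · 1 = compound n P`.)
[cite: Zharkov2020TropicalWeil, p. 2] -/
def weilClass₁ (T : Matrix (Fin n) (Fin n) S) : Matrix (Sub (n + n) n) (Sub (n + n) n) S :=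
  compound n (weilPeriod T) * (weilMatrix₁ n).map (Int.cast : ℤ → S)

/-- The second Weil class of `X_{weilPeriod T}` in V-coordinates: `compound n P · w₂`.
[cite: Zharkov2020TropicalWeil, p. 2] -/
def weilClass₂ (T : Matrix (Fin n) (Fin n) S) : Matrix (Sub (n + n) n) (Sub (n + n) n) S :=
  compound n (weilPeriod T) * (weilMatrix₂ n).map (Int.cast : ℤ → S)

end TropicalTorus

end Literature.AlgebraicGeometry.Tropical

end
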